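import Summits.FinalStateConjecture.FinalStateConjecture.Theses.ZeroEnergyKerrOrBomb
import Literature.Geometry.Lorentzian.KillingModeStability
import Literature.Geometry.Lorentzian.ZeroEnergyRayTrappedModFlow

/-!
# Sketch (crux-ideate, ideator 3, round 1) — crux `KerrOrBomb` (stmt-FinalStateConjecture-10689)

First lemmas of the two idea cards `five-stubs-verbatim` and `mod-flow-cut-dock`:

* `KerrConclusion`, `CoreRigidityGH` — the typed telescope of `KerrOrBomb` minus h5 (`T ≠ 0`,
  redundant by sibling Disproof F8) and minus the mode clause; `kerrOrBomb_of_core` (PROVED,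
  pure logic): the mode-stability clause of the typed crux is idle — any proof of the sibling
  typed crux `ZeroEnergyRigidity ≡ CoreRigidityGH` (line `global-horizon-killing-field`) closes
  `KerrOrBomb` BY NAME through this lemma, without the mis-typed `ErgoregionBomb` (whose typed
  proof needs three un-vendored causality facts) and without waiting for any restate.
* `exists_global_killing_of_h3` (PROVED): the typing lever F3 at THIS crux — h3 hands out a
  Killing field on the whole carrier, non-zero on `𝓔⁺`.
* `ZeroEnergyRigidityModFlowT`, `ErgoregionBombModFlowT` — the INTENDED two halves (trapping
  modulo the flow via the tree predicate `HasZeroEnergyRayTrappedModFlow`, mode class via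
  `IsKillingModeStable`) over the TYPED telescope; `kerrOrBomb_of_modFlow_cut` (PROVED, eight
  lines of logic): the mod-flow cut still closes `KerrOrBomb` by name (the analogue of the
  support item `KerrOrBombOfCruxes` for the repaired statements C″).
-/

noncomputable section

namespace Summit.FinalStateConjecture.FinalStateConjecture.Cruxes.KerrOrBomb.Ideator3

open Literature.Geometry.Lorentzian
open Summit.FinalStateConjecture.FinalStateConjecture.Theses.ZeroEnergyKerrOrBomb
open scoped Manifold

set_option linter.dupNamespace false

/-- The conclusion of `KerrOrBomb` at a hole `𝓑`: d.o.c. isometric to a subextremal Kerr exterior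
in the fact-free immersion form (rev 4). -/
def KerrConclusion (𝓑 : StationaryAFBlackHole.{0}) [Kerr.Facts] : Prop :=
  ∃ (M a : ℝ), Kerr.IsSubextremal M a ∧ ∃ Ψ : Kerr.exterior M a → 𝓑.carrier,
    Function.Injective Ψ ∧ Set.range Ψ = 𝓑.doc ∧
    PseudoRiemannianMetric.IsIsometricImmersion
      (Kerr.smoothMetric M a (Kerr.rPlus M a)).toPseudoRiemannianMetric
      𝓑.metric.toPseudoRiemannianMetric Ψ

/-- Smooth stationary vacuum black-hole uniqueness over the TYPED telescope (h1 vacuum, h2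
connected horizon, h3 `IsNonDegenerateHorizon` = global horizon Killing field, h4 global
hyperbolicity); h5 and the mode clause dropped.  This is the sibling disprover's `CoreRigidityGH`
restated here (their file is a work file, not importable). -/
def CoreRigidityGH : Prop :=
  ∀ (𝓑 : StationaryAFBlackHole.{0}) [𝓑.metric.HasLeviCivita] [Kerr.Facts],
    𝓑.metric.toPseudoRiemannianMetric.IsRicciFlat → IsConnected 𝓑.horizon →
    𝓑.toSpacetime.IsNonDegenerateHorizon 𝓑.Mext →
    𝓑.metric.IsGloballyHyperbolic 𝓑.timeOrientation → KerrConclusion 𝓑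

/-- **First lemma of card `five-stubs-verbatim`**: the typed crux follows from core rigidity by
pure logic — the hypotheses h5 (`T ≠ 0` on the d.o.c.) and h6 (Killing-mode stability) are never
used.  Hence every stub set closing the sibling typed crux `ZeroEnergyRigidity` through
`CoreRigidityGH` closes `KerrOrBomb` verbatim. -/
theorem kerrOrBomb_of_core (h : CoreRigidityGH) : KerrOrBomb := by
  intro 𝓑 _ _ h1 h2 h3 h4 _h5 _h6
  simpa only [KerrConclusion] using h 𝓑 h1 h2 h3 h4

/-- **Typing lever at this crux** (sibling Disproof F3, re-derived): h3 hands out a Killing field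
on the WHOLE carrier which is non-zero and flow-tangent on `𝓔⁺` with a non-zero surface gravity —
the conclusion of Hawking's rigidity theorem as a hypothesis. -/
theorem exists_global_killing_of_h3 (𝓑 : StationaryAFBlackHole.{0}) [𝓑.metric.HasLeviCivita]
    (h3 : 𝓑.toSpacetime.IsNonDegenerateHorizon 𝓑.Mext) :
    ∃ K : Π x : 𝓑.carrier, TangentSpace (𝓡 4) x, 𝓑.metric.IsKillingField K ∧
      (∀ p ∈ 𝓑.horizon, K p ≠ 0) ∧
      ∃ κ : ℝ, κ ≠ 0 ∧ ∀ p ∈ 𝓑.horizon, 𝓑.metric.leviCivita K p (K p) = κ • K p := by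
  obtain ⟨K, hK, hne, -, κ, hκ, hgeo⟩ := h3
  exact ⟨K, hK, hne, κ, hκ, hgeo⟩

/-- INTENDED rigidity half over the typed telescope: no zero-energy null geodesic trapped
modulo the stationary flow (tree predicate, both time directions, maximal geodesics) ⇒ Kerr. -/
def ZeroEnergyRigidityModFlowT : Prop :=
  ∀ (𝓑 : StationaryAFBlackHole.{0}) [𝓑.metric.HasLeviCivita] [Kerr.Facts],
    𝓑.metric.toPseudoRiemannianMetric.IsRicciFlat → IsConnected 𝓑.horizon →
    𝓑.toSpacetime.IsNonDegenerateHorizon 𝓑.Mext →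
    𝓑.metric.IsGloballyHyperbolic 𝓑.timeOrientation →
    ¬ 𝓑.HasZeroEnergyRayTrappedModFlow → KerrConclusion 𝓑

/-- INTENDED bomb half over the typed telescope (= sibling Disproof's C″ `ErgoregionBombModFlow`
minus the redundant h5): a zero-energy null geodesic trapped modulo the flow ⇒ not Killing-mode
stable. -/
def ErgoregionBombModFlowT : Prop :=
  ∀ (𝓑 : StationaryAFBlackHole.{0}) [𝓑.metric.HasLeviCivita] [Kerr.Facts],
    𝓑.metric.toPseudoRiemannianMetric.IsRicciFlat → IsConnected 𝓑.horizon →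
    𝓑.toSpacetime.IsNonDegenerateHorizon 𝓑.Mext →
    𝓑.metric.IsGloballyHyperbolic 𝓑.timeOrientation →
    𝓑.HasZeroEnergyRayTrappedModFlow → ¬ 𝓑.IsKillingModeStable

/-- **First lemma of card `mod-flow-cut-dock`**: the repaired (mod-flow) cut closes the typed crux
by name — a mode-stable hole has no flow-trapped zero-energy geodesic by the bomb half, hence is
Kerr by the rigidity half.  The curried mode clause of `KerrOrBomb` IS `IsKillingModeStable`
(`isKillingModeStable_iff` is `Iff.rfl`). -/
theorem kerrOrBomb_of_modFlow_cut (hR : ZeroEnergyRigidityModFlowT) (hB : ErgoregionBombModFlowT) :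
    KerrOrBomb := by
  intro 𝓑 _ _ h1 h2 h3 h4 _h5 h6
  have hstab : 𝓑.IsKillingModeStable := (StationaryAFBlackHole.isKillingModeStable_iff 𝓑).2 h6
  by_cases ht : 𝓑.HasZeroEnergyRayTrappedModFlow
  · exact absurd hstab (hB 𝓑 h1 h2 h3 h4 ht)
  · simpa only [KerrConclusion] using hR 𝓑 h1 h2 h3 h4 ht

end Summit.FinalStateConjecture.FinalStateConjecture.Cruxes.KerrOrBomb.Ideator3

end
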